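import Summits.AtomisticToContinuum.FouriersLaw.Theorems.PhononMeanFreePathIncoherentChannelLightConeRate

/-!
# The four-point light cone: causality for the crux kernel `C_N = Cov(p₀², K_t p_N²)` itself

Registered stub `powerCov_lightCone` of the lead's skeleton of crux stmt-AtomisticToContinuum-11811
(`Summit.AtomisticToContinuum.FouriersLaw.Theses.PhononMeanFreePath.IncoherentChannel`, line
`two-horizons-forecast-loss`, lead c9), with its reduction `powerCov_sq_le_propagation`.

`P = pinnedChain ω₂ lam β γ` (`ω₂ > 0`, `lam, β, γ ≥ 0` — the harmonic corner is included), `T > 0`,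
`μ₀ = P.gibbsMeasure (N+1) T`, `ν = N(0,T)`, `K_t = P.transitionKernel (N+1) T T t`, `W` the Wiener pair.
The landed `stub_lightCone` (p92940) light-cones the quantities routed through the MEAN forecast
`v_t = K_t p_N` (`r_N²`, `P_N`) by Jensen in the noise. The crux kernel
`C_N(t) = powerCov … N t = Cov_{μ₀}(p₀², K_t p_N²)` involves `w = K_t(p_N²)` instead of `v_t²`, and Jensen
goes the wrong way; but HÖLDER reduces it to the SAME pathwise two-copy light cone (helper 7,
`lightCone_propagation_lintegral`): with `z̃` = `z` with `p₀` resampled from `ν`, `a = p_N(Φ_t(z, B))`,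
`b = p_N(Φ_t(z̃, B))` (same noise),

* `C_N(t) = ∫ p₀² (w(z) − w(z̃)) d(μ₀ ⊗ ν)`                                (`powerCov_resample_eq`),
* `(w(z) − w(z̃))² ≤ E_W[(a − b)²] · 2 (w(z) + w(z̃))`                     (Cauchy–Schwarz in the noise),
* `C_N(t)² ≤ (2M₈ + 2M₄) · E[(a − b)²]`, `M_k = ∫ s^k dν`                    (`powerCov_sq_le_propagation`),

and helper 7 bounds `E[(a − b)²] ≤ 4T e^Λ Λ^N/N! + C t^{2^k}√(N+1)/Λ^{2^k}`; the abstract two-regime rate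
lemma `lightCone_rate_of_sq_le` (p163209) then gives **`powerCov_lightCone`**: for every `η ∈ (0,1)`,
`|C_N(t)| ≤ ε_N` for `0 ≤ t ≤ N^η` with `N^{1+η} ε_N → 0`. Consequences landed separately (p163616,
p163851): the causal window of the full crux integrand carries nothing, and the crux / the conjunct have
post-cone normal forms.
-/

noncomputable section

namespace Summit.AtomisticToContinuum.FouriersLaw.Theorems.PhononMeanFreePath

open MeasureTheory ProbabilityTheory Set Filter Topology
open scoped NNReal ENNReal
open Literature.MathematicalPhysics.KineticTheory.HeatConduction
open Literature.MathematicalPhysics.KineticTheory Literature.Probability.Process OscillatorChain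
open Summit.AtomisticToContinuum.FouriersLaw.Theorems.IncoherentChannel.Negative.GibbsStein (gibbs_sq_momentum)

/-! ### An abstract Hölder step -/

/-- **Hölder through a pointwise product bound.** If `F² ≤ δ·G` pointwise with `δ, G ≥ 0`, `G ∈ L¹`,
`F ∈ L¹`, `δ` measurable with `∫⁻ δ ≤ b`, then `(∫ F)² ≤ b · ∫ G`. [folklore] -/
theorem fourPoint_sq_integral_le {α : Type*} [MeasurableSpace α] {μ : Measure α} {F δ G : α → ℝ} {b : ℝ}
    (hF : Integrable F μ) (hδm : Measurable δ) (hG : Integrable G μ) (hδ0 : ∀ x, 0 ≤ δ x)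
    (hG0 : ∀ x, 0 ≤ G x) (hb : 0 ≤ b) (hδb : ∫⁻ x, ENNReal.ofReal (δ x) ∂μ ≤ ENNReal.ofReal b)
    (h : ∀ x, F x ^ 2 ≤ δ x * G x) :
    (∫ x, F x ∂μ) ^ 2 ≤ b * ∫ x, G x ∂μ := by
  have hδi : Integrable δ μ := by
    refine ⟨hδm.aestronglyMeasurable, ?_⟩
    rw [hasFiniteIntegral_iff_ofReal (Eventually.of_forall hδ0)]
    exact lt_of_le_of_lt hδb ENNReal.ofReal_lt_top
  have hδint : ∫ x, δ x ∂μ ≤ b := by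
    rw [integral_eq_lintegral_of_nonneg_ae (Eventually.of_forall hδ0) hδm.aestronglyMeasurable]
    have := ENNReal.toReal_mono ENNReal.ofReal_ne_top hδb
    rwa [ENNReal.toReal_ofReal hb] at this
  have hpt : ∀ x, |F x| ≤ Real.sqrt (δ x) * Real.sqrt (G x) := fun x => by
    rw [← Real.sqrt_mul (hδ0 x), ← Real.sqrt_sq_eq_abs]
    exact Real.sqrt_le_sqrt (h x)
  have hsm : AEStronglyMeasurable (fun x => Real.sqrt (δ x)) μ :=
    (Real.continuous_sqrt.measurable.comp hδm).aestronglyMeasurable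
  have hsG : AEStronglyMeasurable (fun x => Real.sqrt (G x)) μ :=
    Real.continuous_sqrt.comp_aestronglyMeasurable hG.aestronglyMeasurable
  have hs2 : Integrable (fun x => Real.sqrt (δ x) ^ 2) μ :=
    hδi.congr (Eventually.of_forall fun x => (Real.sq_sqrt (hδ0 x)).symm)
  have hG2 : Integrable (fun x => Real.sqrt (G x) ^ 2) μ :=
    hG.congr (Eventually.of_forall fun x => (Real.sq_sqrt (hG0 x)).symm)
  have hcs := lightCone_integral_mul_sq_le hsm hsG hs2 hG2
  have e1 : ∫ x, Real.sqrt (δ x) ^ 2 ∂μ = ∫ x, δ x ∂μ :=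
    integral_congr_ae (Eventually.of_forall fun x => Real.sq_sqrt (hδ0 x))
  have e2 : ∫ x, Real.sqrt (G x) ^ 2 ∂μ = ∫ x, G x ∂μ :=
    integral_congr_ae (Eventually.of_forall fun x => Real.sq_sqrt (hG0 x))
  rw [e1, e2] at hcs
  have hprod : Integrable (fun x => Real.sqrt (δ x) * Real.sqrt (G x)) μ :=
    lightCone_integrable_mul_of_sq hsm hsG hs2 hG2
  have h1 : |∫ x, F x ∂μ| ≤ ∫ x, Real.sqrt (δ x) * Real.sqrt (G x) ∂μ :=
    (abs_integral_le_integral_abs).trans (integral_mono hF.abs hprod hpt)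
  have hG0' : 0 ≤ ∫ x, G x ∂μ := integral_nonneg hG0
  calc (∫ x, F x ∂μ) ^ 2 = |∫ x, F x ∂μ| ^ 2 := (sq_abs _).symm
    _ ≤ (∫ x, Real.sqrt (δ x) * Real.sqrt (G x) ∂μ) ^ 2 := pow_le_pow_left₀ (abs_nonneg _) h1 2
    _ ≤ (∫ x, δ x ∂μ) * ∫ x, G x ∂μ := hcs
    _ ≤ b * ∫ x, G x ∂μ := mul_le_mul_of_nonneg_right hδint hG0'

/-! ### The kernel average of `p_N²` and its Gibbs moments -/

section Sqcast

variable {ω₂ lam β γ T : ℝ} (hω : 0 < ω₂) (hl : 0 ≤ lam) (hβ : 0 ≤ β) (hγ : 0 ≤ γ) (hT : 0 < T) (N : ℕ) (t : ℝ)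
include hω hl hβ hγ hT

/-- Moments of `w = K_t(p_N²)` under the Gibbs state: `w` is measurable, `0 ≤ w`, `w, w² ∈ L¹(μ₀)` and
`∫ w² dμ₀ ≤ ∫ s⁴ dN(0,T)` (kernel Jensen `w² ≤ K_t(p_N⁴)` + invariance of `μ₀`). [folklore] -/
theorem fourPoint_sqcast_moments {w : PhaseSpace (N + 1) → ℝ}
    (hw : ∀ z, w z = ∫ y, y.2 (Fin.last N) ^ 2 ∂((pinnedChain ω₂ lam β γ).transitionKernel (N + 1) T T t.toNNReal z)) :
    Measurable w ∧ (∀ z, 0 ≤ w z) ∧ Integrable w ((pinnedChain ω₂ lam β γ).gibbsMeasure (N + 1) T) ∧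
      Integrable (fun z => w z ^ 2) ((pinnedChain ω₂ lam β γ).gibbsMeasure (N + 1) T) ∧
      ∫ z, w z ^ 2 ∂((pinnedChain ω₂ lam β γ).gibbsMeasure (N + 1) T) ≤ ∫ s, s ^ 4 ∂(gaussianReal 0 T.toNNReal) := by
  set P := pinnedChain ω₂ lam β γ with hP
  set μ₀ := P.gibbsMeasure (N + 1) T with hμ₀
  have hwf : w = fun z => ∫ y, y.2 (Fin.last N) ^ 2 ∂(P.transitionKernel (N + 1) T T t.toNNReal z) := funext hw
  haveI := pinnedChain_isMarkovKernel_transitionKernel hω hl hβ hγ (N + 1) T T t.toNNReal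
  have hmeas : Measurable w := by
    have h : StronglyMeasurable fun y : PhaseSpace (N + 1) => y.2 (Fin.last N) ^ 2 :=
      (((measurable_pi_apply (Fin.last N)).comp measurable_snd).pow_const 2).stronglyMeasurable
    rw [hwf]
    exact (h.integral_kernel (κ := P.transitionKernel (N + 1) T T t.toNNReal)).measurable
  have h0 : ∀ z, 0 ≤ w z := fun z => by rw [hw z]; exact integral_nonneg fun y => sq_nonneg _
  have h2 := lightCone_integrable_kernel_integral hω hl hβ hγ hT t.toNNReal
    (g := fun y : PhaseSpace (N + 1) => y.2 (Fin.last N) ^ 2) (by fun_prop) (fun y => sq_nonneg _)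
    (lightCone_integrable_momentum_pow hω hl hβ hT (Fin.last N) 2)
  have h4 := lightCone_integrable_kernel_integral hω hl hβ hγ hT t.toNNReal
    (g := fun y : PhaseSpace (N + 1) => y.2 (Fin.last N) ^ 4) (by fun_prop) (fun y => by positivity)
    (lightCone_integrable_momentum_pow hω hl hβ hT (Fin.last N) 4)
  -- kernel Jensen: `w² ≤ K_t(p_N⁴)`
  have hJ : ∀ z, w z ^ 2 ≤ ∫ y, y.2 (Fin.last N) ^ 4 ∂(P.transitionKernel (N + 1) T T t.toNNReal z) := by
    intro z
    have hI : Integrable (fun y : PhaseSpace (N + 1) => (y.2 (Fin.last N) ^ 2) ^ 2)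
        (P.transitionKernel (N + 1) T T t.toNNReal z) := by
      have := lightCone_integrable_pow_four_transitionKernel hω hl hβ hγ hT t.toNNReal z (Fin.last N)
      exact this.congr (Eventually.of_forall fun y => by ring)
    have hj := lightCone_sq_integral_le
      (by fun_prop : Continuous fun y : PhaseSpace (N + 1) => y.2 (Fin.last N) ^ 2).aestronglyMeasurable hI
    rw [hw z]
    exact hj.trans_eq (integral_congr_ae (Eventually.of_forall fun y => by ring))
  have hI1 : Integrable w μ₀ := by rw [hwf]; exact h2.1
  have hI2 : Integrable (fun z => w z ^ 2) μ₀ :=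
    h4.1.mono' (hmeas.pow_const 2).aestronglyMeasurable (Eventually.of_forall fun z => by
      rw [Real.norm_eq_abs, abs_of_nonneg (sq_nonneg _)]
      exact hJ z)
  refine ⟨hmeas, h0, hI1, hI2, ?_⟩
  calc ∫ z, w z ^ 2 ∂μ₀ ≤ ∫ z, (∫ y, y.2 (Fin.last N) ^ 4 ∂(P.transitionKernel (N + 1) T T t.toNNReal z)) ∂μ₀ :=
        integral_mono hI2 h4.1 hJ
    _ = ∫ y, y.2 (Fin.last N) ^ 4 ∂μ₀ := h4.2
    _ = ∫ s, s ^ 4 ∂(gaussianReal 0 T.toNNReal) := lightCone_integral_momentum_pow hω hl hβ hT (Fin.last N) 4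

/-- **Resampling identity for the crux kernel**: `C_N(t) = ∫ p₀² (w(z) − w(z̃)) d(μ₀ ⊗ ν)`, `w = K_t(p_N²)`
(`∫ p₀² w(z̃) = (∫ s² dν)(∫ w dμ₀) = T ∫ w dμ₀`, and `∫ p₀² dμ₀ = T`). [folklore] -/
theorem powerCov_resample_eq :
    powerCov ω₂ lam β γ T N t =
      ∫ x : PhaseSpace (N + 1) × ℝ, x.1.2 0 ^ 2 *
        ((∫ y, y.2 (Fin.last N) ^ 2 ∂((pinnedChain ω₂ lam β γ).transitionKernel (N + 1) T T t.toNNReal x.1)) -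
          ∫ y, y.2 (Fin.last N) ^ 2 ∂((pinnedChain ω₂ lam β γ).transitionKernel (N + 1) T T t.toNNReal
            ((x.1.1, Function.update x.1.2 0 x.2) : PhaseSpace (N + 1))))
        ∂(((pinnedChain ω₂ lam β γ).gibbsMeasure (N + 1) T).prod (gaussianReal 0 T.toNNReal)) := by
  set P := pinnedChain ω₂ lam β γ with hP
  set μ₀ := P.gibbsMeasure (N + 1) T with hμ₀
  set ν := gaussianReal 0 T.toNNReal with hν
  set w : PhaseSpace (N + 1) → ℝ := fun z => ∫ y, y.2 (Fin.last N) ^ 2 ∂(P.transitionKernel (N + 1) T T t.toNNReal z)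
    with hwdef
  set R : PhaseSpace (N + 1) × ℝ → PhaseSpace (N + 1) := fun x => (x.1.1, Function.update x.1.2 0 x.2) with hR
  show (∫ z, z.2 0 ^ 2 * w z ∂μ₀) - (∫ z, z.2 0 ^ 2 ∂μ₀) * (∫ z, w z ∂μ₀) = ∫ x, x.1.2 0 ^ 2 * (w x.1 - w (R x)) ∂(μ₀.prod ν)
  haveI : IsProbabilityMeasure μ₀ := pinnedChain_isProbabilityMeasure_gibbsMeasure hω hl hβ γ (N + 1) hT
  obtain ⟨hwm, -, hw1, hw2, -⟩ := fourPoint_sqcast_moments hω hl hβ hγ hT N t (w := w) (fun z => rfl)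
  have hpm : Measurable fun z : PhaseSpace (N + 1) => z.2 0 := (measurable_pi_apply 0).comp measurable_snd
  have hp4 : Integrable (fun z : PhaseSpace (N + 1) => (z.2 0 ^ 2) ^ 2) μ₀ :=
    (lightCone_integrable_momentum_pow hω hl hβ hT 0 4).congr (Eventually.of_forall fun z => by ring)
  have hI0 : Integrable (fun z : PhaseSpace (N + 1) => z.2 0 ^ 2 * w z) μ₀ :=
    lightCone_integrable_mul_of_sq (hpm.pow_const 2).aestronglyMeasurable hwm.aestronglyMeasurable hp4 hw2
  have hI1 : Integrable (fun x : PhaseSpace (N + 1) × ℝ => x.1.2 0 ^ 2 * w x.1) (μ₀.prod ν) := hI0.comp_fst ν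
  have hI2 : Integrable (fun x : PhaseSpace (N + 1) × ℝ => x.1.2 0 ^ 2 * w (R x)) (μ₀.prod ν) :=
    lightCone_integrable_mul_of_sq ((hpm.comp measurable_fst).pow_const 2).aestronglyMeasurable
      (hwm.comp (lightCone_measurable_resample 0)).aestronglyMeasurable (hp4.comp_fst ν)
      (lightCone_integrable_comp_resample hω hl hβ hT N (F := fun z => w z ^ 2)
        (hwm.pow_const 2).aestronglyMeasurable hw2)
  have hT2 : ∫ s, s ^ 2 ∂ν = T := by
    rw [hν, ← lightCone_integral_momentum_pow hω hl hβ hT (0 : Fin (N + 1)) 2 (γ := γ)]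
    exact gibbs_sq_momentum hω hl hβ hT 0
  have h0 : ∫ x : PhaseSpace (N + 1) × ℝ, x.1.2 0 ^ 2 * w (R x) ∂(μ₀.prod ν) = T * ∫ z, w z ∂μ₀ := by
    have := lightCone_integral_momentum_mul_comp_resample (γ := γ) hω hl hβ hT N (h := fun s => s ^ 2)
      (F := w) (measurable_id.pow_const 2) hwm
    rw [this, hT2]
  simp_rw [mul_sub]
  rw [integral_sub hI1 hI2, h0, integral_fun_fst (fun z : PhaseSpace (N + 1) => z.2 0 ^ 2 * w z),
    probReal_univ, one_smul, gibbs_sq_momentum hω hl hβ hT 0]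

end Sqcast

/-! ### The pathwise step: Cauchy–Schwarz in the noise, then Hölder in the initial data -/

section Pathwise

variable {ω₂ lam β γ T : ℝ} (hω : 0 < ω₂) (hl : 0 ≤ lam) (hβ : 0 ≤ β) (hγ : 0 ≤ γ) (hT : 0 < T) (N : ℕ)
include hω hl hβ hγ hT

/-- **Cauchy–Schwarz in the noise**: for `t ≥ 0` and two initial states `z, z'` driven by the SAME noise,
`(w(z) − w(z'))² ≤ E_W[(p_N(Φ_t z) − p_N(Φ_t z'))²] · 2 (w(z) + w(z'))`, `w = K_t(p_N²) = E_W[p_N(Φ_t ·)²]`. [folklore] -/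
theorem fourPoint_sqcast_sub_sq_le {t : ℝ} (ht : 0 ≤ t) (z z' : PhaseSpace (N + 1)) :
    ((∫ y, y.2 (Fin.last N) ^ 2 ∂((pinnedChain ω₂ lam β γ).transitionKernel (N + 1) T T t.toNNReal z)) -
        ∫ y, y.2 (Fin.last N) ^ 2 ∂((pinnedChain ω₂ lam β γ).transitionKernel (N + 1) T T t.toNNReal z')) ^ 2 ≤
      (∫ ω, (((pinnedChain ω₂ lam β γ).solMap (N + 1) T T t z (pairPath ω)).2 (Fin.last N) -
          ((pinnedChain ω₂ lam β γ).solMap (N + 1) T T t z' (pairPath ω)).2 (Fin.last N)) ^ 2 ∂wienerPair) *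
        (2 * ((∫ y, y.2 (Fin.last N) ^ 2 ∂((pinnedChain ω₂ lam β γ).transitionKernel (N + 1) T T t.toNNReal z)) +
          ∫ y, y.2 (Fin.last N) ^ 2 ∂((pinnedChain ω₂ lam β γ).transitionKernel (N + 1) T T t.toNNReal z'))) := by
  set P := pinnedChain ω₂ lam β γ with hP
  set tN : ℝ≥0 := ⟨t, ht⟩ with htN
  have htt : ((tN : ℝ≥0) : ℝ) = t := rfl
  -- the two copies as functions of the noise
  set a : WienerPair → ℝ := fun ω => (P.solMap (N + 1) T T t z (pairPath ω)).2 (Fin.last N) with ha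
  set b : WienerPair → ℝ := fun ω => (P.solMap (N + 1) T T t z' (pairPath ω)).2 (Fin.last N) with hb
  obtain ⟨h1, h2⟩ := lightCone_integrable_far_solMap hω hl hβ hγ hT N tN z
  obtain ⟨h1', h2'⟩ := lightCone_integrable_far_solMap hω hl hβ hγ hT N tN z'
  rw [htt] at h1 h2 h1' h2'
  change Integrable a wienerPair at h1
  change Integrable (fun ω => a ω ^ 2) wienerPair at h2
  change Integrable b wienerPair at h1'
  change Integrable (fun ω => b ω ^ 2) wienerPair at h2'
  -- `w(z) = ∫ a²`, `w(z') = ∫ b²`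
  have hwa : ∫ y, y.2 (Fin.last N) ^ 2 ∂(P.transitionKernel (N + 1) T T t.toNNReal z) = ∫ ω, a ω ^ 2 ∂wienerPair := by
    have h := pinnedChain_integral_transitionKernel hω hl hβ hγ (N + 1) T T t.toNNReal z
      (g := fun y : PhaseSpace (N + 1) => y.2 (Fin.last N) ^ 2)
      (by fun_prop : Continuous fun y : PhaseSpace (N + 1) => y.2 (Fin.last N) ^ 2).aestronglyMeasurable
    rw [Real.coe_toNNReal t ht] at h
    exact h
  have hwb : ∫ y, y.2 (Fin.last N) ^ 2 ∂(P.transitionKernel (N + 1) T T t.toNNReal z') = ∫ ω, b ω ^ 2 ∂wienerPair := by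
    have h := pinnedChain_integral_transitionKernel hω hl hβ hγ (N + 1) T T t.toNNReal z'
      (g := fun y : PhaseSpace (N + 1) => y.2 (Fin.last N) ^ 2)
      (by fun_prop : Continuous fun y : PhaseSpace (N + 1) => y.2 (Fin.last N) ^ 2).aestronglyMeasurable
    rw [Real.coe_toNNReal t ht] at h
    exact h
  rw [hwa, hwb]
  change (∫ ω, a ω ^ 2 ∂wienerPair - ∫ ω, b ω ^ 2 ∂wienerPair) ^ 2 ≤
    (∫ ω, (a ω - b ω) ^ 2 ∂wienerPair) * (2 * (∫ ω, a ω ^ 2 ∂wienerPair + ∫ ω, b ω ^ 2 ∂wienerPair))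
  have hsub : Integrable (fun ω => (a ω - b ω) ^ 2) wienerPair := by
    refine ((h2.add h2').const_mul 2).mono' ((h1.sub h1').aestronglyMeasurable.pow 2) (Eventually.of_forall fun ω => ?_)
    rw [Real.norm_eq_abs, abs_of_nonneg (sq_nonneg _)]
    simp only [Pi.add_apply]
    nlinarith [sq_nonneg (a ω + b ω)]
  have hadd : Integrable (fun ω => (a ω + b ω) ^ 2) wienerPair := by
    refine ((h2.add h2').const_mul 2).mono' ((h1.add h1').aestronglyMeasurable.pow 2) (Eventually.of_forall fun ω => ?_)
    rw [Real.norm_eq_abs, abs_of_nonneg (sq_nonneg _)]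
    simp only [Pi.add_apply]
    nlinarith [sq_nonneg (a ω - b ω)]
  have hdiff : ∫ ω, a ω ^ 2 ∂wienerPair - ∫ ω, b ω ^ 2 ∂wienerPair = ∫ ω, (a ω - b ω) * (a ω + b ω) ∂wienerPair := by
    rw [← integral_sub h2 h2']
    exact integral_congr_ae (Eventually.of_forall fun ω => by ring)
  have hcs := lightCone_integral_mul_sq_le (h1.sub h1').aestronglyMeasurable (h1.add h1').aestronglyMeasurable hsub hadd
  have hsum : ∫ ω, (a ω + b ω) ^ 2 ∂wienerPair ≤ 2 * (∫ ω, a ω ^ 2 ∂wienerPair + ∫ ω, b ω ^ 2 ∂wienerPair) := by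
    have hle : ∫ ω, (a ω + b ω) ^ 2 ∂wienerPair ≤ ∫ ω, (2 * a ω ^ 2 + 2 * b ω ^ 2) ∂wienerPair :=
      integral_mono hadd ((h2.const_mul 2).add (h2'.const_mul 2)) fun ω => by
        change (a ω + b ω) ^ 2 ≤ 2 * a ω ^ 2 + 2 * b ω ^ 2
        nlinarith [sq_nonneg (a ω - b ω)]
    rw [integral_add (h2.const_mul 2) (h2'.const_mul 2), integral_const_mul, integral_const_mul] at hle
    linarith
  have hD0 : 0 ≤ ∫ ω, (a ω - b ω) ^ 2 ∂wienerPair := integral_nonneg fun ω => sq_nonneg _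
  rw [hdiff]
  exact hcs.trans (mul_le_mul_of_nonneg_left hsum hD0)

end Pathwise

/-! ### The reduction `C_N(t)² ≤ (2M₈ + 2M₄) · E[(a − b)²]` and the stub -/

/-- **Reduction of the crux kernel to the pathwise two-copy light cone.** For every `k` there is `C ≥ 0`
with `C_N(t)² ≤ (2∫s⁸dν + 2∫s⁴dν) · (4T e^Λ Λ^N/N! + C t^{2^k}√(N+1)/Λ^{2^k})` for all `N`, `t ≥ 0`, `Λ > 0`
(`ν = N(0,T)`; `C` is the constant of helper 7 `lightCone_propagation_lintegral`). [folklore] -/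
theorem powerCov_sq_le_propagation : ∀ ω₂ lam β γ : ℝ, 0 < ω₂ → 0 ≤ lam → 0 ≤ β → 0 ≤ γ → ∀ T : ℝ, 0 < T →
    ∀ k : ℕ, ∃ C : ℝ, 0 ≤ C ∧ ∀ (N : ℕ) (t : ℝ), 0 ≤ t → ∀ Λ : ℝ, 0 < Λ →
      (powerCov ω₂ lam β γ T N t) ^ 2 ≤
        (2 * ∫ s, s ^ 8 ∂(gaussianReal 0 T.toNNReal) + 2 * ∫ s, s ^ 4 ∂(gaussianReal 0 T.toNNReal)) *
          (4 * T * (Real.exp Λ * Λ ^ N / N.factorial) + C * t ^ (2 ^ k) * Real.sqrt (N + 1) / Λ ^ (2 ^ k)) := by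
  intro ω₂ lam β γ hω hl hβ hγ T hT k
  obtain ⟨C, hC0, hC⟩ := lightCone_propagation_lintegral ω₂ lam β γ hω hl hβ hγ T hT k
  refine ⟨C, hC0, fun N t ht Λ hΛ => ?_⟩
  set P := pinnedChain ω₂ lam β γ with hP
  set μ₀ := P.gibbsMeasure (N + 1) T with hμ₀
  set ν := gaussianReal 0 T.toNNReal with hν
  set M4 : ℝ := ∫ s, s ^ 4 ∂ν with hM4
  set M8 : ℝ := ∫ s, s ^ 8 ∂ν with hM8
  set b0 : ℝ := 4 * T * (Real.exp Λ * Λ ^ N / N.factorial) + C * t ^ (2 ^ k) * Real.sqrt (N + 1) / Λ ^ (2 ^ k) with hb0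
  have hb00 : 0 ≤ b0 := by positivity
  haveI : IsProbabilityMeasure μ₀ := pinnedChain_isProbabilityMeasure_gibbsMeasure hω hl hβ γ (N + 1) hT
  set w : PhaseSpace (N + 1) → ℝ := fun z => ∫ y, y.2 (Fin.last N) ^ 2 ∂(P.transitionKernel (N + 1) T T t.toNNReal z)
    with hwdef
  set R : PhaseSpace (N + 1) × ℝ → PhaseSpace (N + 1) := fun x => (x.1.1, Function.update x.1.2 0 x.2) with hR
  have hRm : Measurable R := lightCone_measurable_resample 0
  obtain ⟨hwm, hw0, -, hw2, hw2le⟩ := fourPoint_sqcast_moments hω hl hβ hγ hT N t (w := w) (fun z => rfl)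
  -- the three players `F`, `δ`, `G` on `μ₀ ⊗ ν`
  set a : (PhaseSpace (N + 1) × ℝ) × WienerPair → ℝ := fun q => (P.solMap (N + 1) T T t q.1.1 (pairPath q.2)).2 (Fin.last N)
    with ha
  set b : (PhaseSpace (N + 1) × ℝ) × WienerPair → ℝ := fun q => (P.solMap (N + 1) T T t (R q.1) (pairPath q.2)).2 (Fin.last N)
    with hb
  have ham : Measurable a := ((measurable_pi_apply _).comp measurable_snd).comp (lightCone_measurable_solMap_fst hω hl hβ hγ N T t)
  have hbm : Measurable b :=
    ((measurable_pi_apply _).comp measurable_snd).comp (lightCone_measurable_solMap_resample hω hl hβ hγ N T t)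
  set δ : PhaseSpace (N + 1) × ℝ → ℝ := fun x => ∫ ω, (a (x, ω) - b (x, ω)) ^ 2 ∂wienerPair with hδ
  set F : PhaseSpace (N + 1) × ℝ → ℝ := fun x => x.1.2 0 ^ 2 * (w x.1 - w (R x)) with hF
  set G : PhaseSpace (N + 1) × ℝ → ℝ := fun x => 2 * (x.1.2 0 ^ 4 * (w x.1 + w (R x))) with hG
  have hpm : Measurable fun z : PhaseSpace (N + 1) => z.2 0 := (measurable_pi_apply 0).comp measurable_snd
  have hpx : Measurable fun x : PhaseSpace (N + 1) × ℝ => x.1.2 0 := hpm.comp measurable_fst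
  -- `δ` is measurable and non-negative, and its lintegral is the triple lintegral of helper 7
  have hδm : Measurable δ :=
    (((ham.sub hbm).pow_const 2).stronglyMeasurable.integral_prod_right' (ν := wienerPair)).measurable
  have hδ0 : ∀ x, 0 ≤ δ x := fun x => integral_nonneg fun ω => sq_nonneg _
  have hδb : ∫⁻ x, ENNReal.ofReal (δ x) ∂(μ₀.prod ν) ≤ ENNReal.ofReal b0 := by
    have hpt : ∀ x : PhaseSpace (N + 1) × ℝ,
        ENNReal.ofReal (δ x) = ∫⁻ ω, ENNReal.ofReal ((a (x, ω) - b (x, ω)) ^ 2) ∂wienerPair := by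
      intro x
      set tN : ℝ≥0 := ⟨t, ht⟩ with htN
      have htt : ((tN : ℝ≥0) : ℝ) = t := rfl
      obtain ⟨h1, h2⟩ := lightCone_integrable_far_solMap hω hl hβ hγ hT N tN x.1
      obtain ⟨h1', h2'⟩ := lightCone_integrable_far_solMap hω hl hβ hγ hT N tN (R x)
      rw [htt] at h1 h2 h1' h2'
      have hint : Integrable (fun ω => (a (x, ω) - b (x, ω)) ^ 2) wienerPair := by
        refine ((h2.add h2').const_mul 2).mono' ((h1.sub h1').aestronglyMeasurable.pow 2) (Eventually.of_forall fun ω => ?_)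
        rw [Real.norm_eq_abs, abs_of_nonneg (sq_nonneg _)]
        simp only [Pi.add_apply, ha, hb]
        nlinarith [sq_nonneg (((P.solMap (N + 1) T T t x.1 (pairPath ω)).2 (Fin.last N)) +
          ((P.solMap (N + 1) T T t (R x) (pairPath ω)).2 (Fin.last N)))]
      exact ofReal_integral_eq_lintegral_ofReal hint (Eventually.of_forall fun ω => sq_nonneg _)
    calc ∫⁻ x, ENNReal.ofReal (δ x) ∂(μ₀.prod ν)
        = ∫⁻ x, ∫⁻ ω, ENNReal.ofReal ((a (x, ω) - b (x, ω)) ^ 2) ∂wienerPair ∂(μ₀.prod ν) := lintegral_congr hpt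
      _ = ∫⁻ q, ENNReal.ofReal ((a q - b q) ^ 2) ∂((μ₀.prod ν).prod wienerPair) :=
          (lintegral_prod _ ((ham.sub hbm).pow_const 2).ennreal_ofReal.aemeasurable).symm
      _ ≤ ENNReal.ofReal b0 := hC N t ht Λ hΛ
  -- `G` is integrable with `∫ G ≤ 2M₈ + 2M₄`
  have hG0 : ∀ x, 0 ≤ G x := fun x => by
    simp only [hG]
    have := hw0 x.1; have := hw0 (R x); positivity
  have hp8x : Integrable (fun x : PhaseSpace (N + 1) × ℝ => x.1.2 0 ^ 8) (μ₀.prod ν) :=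
    (lightCone_integrable_momentum_pow hω hl hβ hT 0 8).comp_fst ν
  have hw2x : Integrable (fun x : PhaseSpace (N + 1) × ℝ => w x.1 ^ 2) (μ₀.prod ν) := hw2.comp_fst ν
  have hw2R : Integrable (fun x : PhaseSpace (N + 1) × ℝ => w (R x) ^ 2) (μ₀.prod ν) :=
    lightCone_integrable_comp_resample hω hl hβ hT N (F := fun z => w z ^ 2) (hwm.pow_const 2).aestronglyMeasurable hw2
  have hmaj : Integrable (fun x : PhaseSpace (N + 1) × ℝ => (x.1.2 0 ^ 8 + w x.1 ^ 2) + (x.1.2 0 ^ 8 + w (R x) ^ 2))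
      (μ₀.prod ν) := (hp8x.add hw2x).add (hp8x.add hw2R)
  have hGle : ∀ x : PhaseSpace (N + 1) × ℝ, G x ≤ (x.1.2 0 ^ 8 + w x.1 ^ 2) + (x.1.2 0 ^ 8 + w (R x) ^ 2) := by
    intro x
    simp only [hG]
    nlinarith [sq_nonneg (x.1.2 0 ^ 4 - w x.1), sq_nonneg (x.1.2 0 ^ 4 - w (R x))]
  have hGm : Measurable G := (((hpx.pow_const 4).mul ((hwm.comp measurable_fst).add (hwm.comp hRm))).const_mul 2)
  have hGi : Integrable G (μ₀.prod ν) :=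
    hmaj.mono' hGm.aestronglyMeasurable (Eventually.of_forall fun x => by
      rw [Real.norm_eq_abs, abs_of_nonneg (hG0 x)]; exact hGle x)
  have hGint : ∫ x, G x ∂(μ₀.prod ν) ≤ 2 * M8 + 2 * M4 := by
    have hle := integral_mono hGi hmaj hGle
    have h8 : ∫ x : PhaseSpace (N + 1) × ℝ, x.1.2 0 ^ 8 ∂(μ₀.prod ν) = M8 := by
      rw [integral_fun_fst (fun z : PhaseSpace (N + 1) => z.2 0 ^ 8), probReal_univ, one_smul]
      exact lightCone_integral_momentum_pow hω hl hβ hT 0 8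
    have h4a : ∫ x : PhaseSpace (N + 1) × ℝ, w x.1 ^ 2 ∂(μ₀.prod ν) ≤ M4 := by
      rw [integral_fun_fst (fun z : PhaseSpace (N + 1) => w z ^ 2), probReal_univ, one_smul]
      exact hw2le
    have h4b : ∫ x : PhaseSpace (N + 1) × ℝ, w (R x) ^ 2 ∂(μ₀.prod ν) ≤ M4 := by
      have : ∫ x : PhaseSpace (N + 1) × ℝ, w (R x) ^ 2 ∂(μ₀.prod ν) = ∫ z, w z ^ 2 ∂μ₀ :=
        lightCone_integral_comp_resample hω hl hβ hT N (F := fun z => w z ^ 2) (hwm.pow_const 2)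
      rw [this]; exact hw2le
    have hA : Integrable (fun x : PhaseSpace (N + 1) × ℝ => x.1.2 0 ^ 8 + w x.1 ^ 2) (μ₀.prod ν) := hp8x.add hw2x
    have hB : Integrable (fun x : PhaseSpace (N + 1) × ℝ => x.1.2 0 ^ 8 + w (R x) ^ 2) (μ₀.prod ν) := hp8x.add hw2R
    rw [integral_add hA hB, integral_add hp8x hw2x, integral_add hp8x hw2R] at hle
    linarith
  -- `F` is integrable and `F² ≤ δ G`
  have hp4 : Integrable (fun z : PhaseSpace (N + 1) => (z.2 0 ^ 2) ^ 2) μ₀ :=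
    (lightCone_integrable_momentum_pow hω hl hβ hT 0 4).congr (Eventually.of_forall fun z => by ring)
  have hI1 : Integrable (fun x : PhaseSpace (N + 1) × ℝ => x.1.2 0 ^ 2 * w x.1) (μ₀.prod ν) :=
    (lightCone_integrable_mul_of_sq (hpm.pow_const 2).aestronglyMeasurable hwm.aestronglyMeasurable hp4 hw2).comp_fst ν
  have hI2 : Integrable (fun x : PhaseSpace (N + 1) × ℝ => x.1.2 0 ^ 2 * w (R x)) (μ₀.prod ν) :=
    lightCone_integrable_mul_of_sq ((hpm.comp measurable_fst).pow_const 2).aestronglyMeasurable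
      (hwm.comp hRm).aestronglyMeasurable (hp4.comp_fst ν) hw2R
  have hFi : Integrable F (μ₀.prod ν) := by
    have := hI1.sub hI2
    refine this.congr (Eventually.of_forall fun x => ?_)
    simp only [hF, Pi.sub_apply]; ring
  have hFδG : ∀ x, F x ^ 2 ≤ δ x * G x := by
    intro x
    have hpw := fourPoint_sqcast_sub_sq_le hω hl hβ hγ hT N ht x.1 (R x)
    have hp0 : 0 ≤ x.1.2 0 ^ 4 := by positivity
    have := mul_le_mul_of_nonneg_left hpw hp0
    simp only [hF, hG, hδ, ha, hb]
    calc (x.1.2 0 ^ 2 * (w x.1 - w (R x))) ^ 2 = x.1.2 0 ^ 4 * (w x.1 - w (R x)) ^ 2 := by ring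
      _ ≤ _ := this
      _ = _ := by ring
  -- Hölder
  have hH := fourPoint_sq_integral_le hFi hδm hGi hδ0 hG0 hb00 hδb hFδG
  have hCN : powerCov ω₂ lam β γ T N t = ∫ x, F x ∂(μ₀.prod ν) := powerCov_resample_eq hω hl hβ hγ hT N t
  rw [hCN]
  have hK0 : 0 ≤ 2 * M8 + 2 * M4 := by
    have h8 : 0 ≤ M8 := integral_nonneg fun s => by positivity
    have h4 : 0 ≤ M4 := integral_nonneg fun s => by positivity
    linarith
  calc (∫ x, F x ∂(μ₀.prod ν)) ^ 2 ≤ b0 * ∫ x, G x ∂(μ₀.prod ν) := hH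
    _ ≤ b0 * (2 * M8 + 2 * M4) := mul_le_mul_of_nonneg_left hGint hb00
    _ = (2 * M8 + 2 * M4) * b0 := mul_comm _ _

/-- **Stub `powerCov_lightCone` (THE FOUR-POINT LIGHT CONE).** For the pinned chain (`ω₂ > 0`,
`lam, β, γ ≥ 0`) at `T > 0` and every `0 < η < 1` there is `ε_N` with `N^{1+η} ε_N → 0` such that the
power covariance of the two END kinetic energies satisfies `|C_N(t)| ≤ ε_N` for all `0 ≤ t ≤ N^η` and all
`N`: no correlation between `p₀²` and `K_t p_N²` before a signal can cross — reduction
`powerCov_sq_le_propagation` + the abstract two-regime rate lemma `lightCone_rate_of_sq_le`. [folklore] -/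
theorem powerCov_lightCone : ∀ ω₂ lam β γ : ℝ, 0 < ω₂ → 0 ≤ lam → 0 ≤ β → 0 ≤ γ → ∀ T : ℝ, 0 < T → ∀ η : ℝ, 0 < η → η < 1 → ∃ ε : ℕ → ℝ, Tendsto (fun N : ℕ => (N : ℝ) ^ (1 + η) * ε N) atTop (𝓝 0) ∧ ∀ (N : ℕ) (t : ℝ), 0 ≤ t → t ≤ (N : ℝ) ^ η → |powerCov ω₂ lam β γ T N t| ≤ ε N := by
  intro ω₂ lam β γ hω hl hβ hγ T hT η hη hη1
  have hK0 : 0 ≤ 2 * ∫ s, s ^ 8 ∂(gaussianReal 0 T.toNNReal) + 2 * ∫ s, s ^ 4 ∂(gaussianReal 0 T.toNNReal) := by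
    have h8 : 0 ≤ ∫ s, s ^ 8 ∂(gaussianReal 0 T.toNNReal) := integral_nonneg fun s => by positivity
    have h4 : 0 ≤ ∫ s, s ^ 4 ∂(gaussianReal 0 T.toNNReal) := integral_nonneg fun s => by positivity
    linarith
  exact lightCone_rate_of_sq_le (X := fun N t => powerCov ω₂ lam β γ T N t) hK0 hT.le
    (powerCov_sq_le_propagation ω₂ lam β γ hω hl hβ hγ T hT) hη hη1

end Summit.AtomisticToContinuum.FouriersLaw.Theorems.PhononMeanFreePath

end
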